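import Summits.QuantumFields.YangMills.Theorems.BalabanUVNodesN07PointFeasibilityOneLevel
import HarnessLib

/-!
# DAG node N07 [B11], road R0′ — LEMMA (P) ONE LEVEL, THE EXISTENCE HALF: «for every centre datum `λ` there is EXACTLY ONE fine scalar `μ` on
# `T_η = Tor (fine n M)` with `μ(ny + c₀) = λ(y)` for all `y` and `R(Δμ) = 0`» — the one-level R0′-native junction (`hker` ∧ the count `hdim` of
# `N07FlatHFeasibility.exists_admissible_grad_of_flatKernel`) as ONE rank–nullity sentence over ℂ (file 5 of the (P) lineage)

Cell `pub-ymgap` (HUMAN RULINGS D-0062 ∕ D-0149 ∕ D-0154), width seat `pub-ymgap-dag-n07-w5` g3 (harness re-seat 2026-08-28 12:30Z), CLAIM-1 ∕ INTENT-1 cell bus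
2026-08-28T12:41Z.  `--kind proof --supports stmt-QuantumFields-27364 --as helper` (K1⁹ per dag-lead KEY MAP v2; count-neutral).  THEOREMS ONLY.

THE PRINT.  [B5] = T. Bałaban, *Propagators and renormalization transformations for lattice gauge theories. I*, Commun. Math. Phys. **95** (1984) 17–40
`[Balaban1984PropagatorsI]`: p. 22 («Q′_kΔ⁻²Q′*_k … its inverse on this subspace»), p. 25 («R … an orthogonal projection on the linear subspace ΔN(Q′_k) of L²(T_η)»),
(1.69)–(1.70) pp. 29–30; [B6] = CMP **96** (1984) 223–250 `[Balaban1984PropagatorsII]`, (2.9)–(2.12) p. 225 (the constraints `QA = B`, `R∂*A = 0`), (2.22) p. 226,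
(2.35) p. 228 («The only assumption we have used was the positivity of the operator Δ_a»); [B7] = CMP **98** (1985) 17–51 `[Balaban1985Averaging]` (11) p. 18 (the
average of a pure gauge); [I] = CMP **109** (1987) 249–301 `[Balaban1987RG1]`, (0.4) p. 253 (the averaging of record: block CENTRES, odd `L`).

WHY (road R0′ of record; dag-n07-e `LOCATED-POINT-FEASIBILITY.md` junction audit: «`hker` = S4's `hpos` in record letters = EXISTENCE of a Landau right inverse of
`Q_j(1)` = lemma (P)»).  The (0.4) linearised average sends a fine pure gauge to the coarse pure gauge OF THE CENTRE VALUES (`Q_k(1)(∂μ) = ∂(μ ∘ centres)`: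
k0-s1-w1 `K0Stub1FlatAveragingDictionary.dIterL_one_grad`, ym3-torus `AlphaInputsT3ACv3AbelianLiftAvg.linAvg04_cobd` — cited, not imported), so an
ADMISSIBLE pure gauge at the coarse datum `∂_cλ` ([B6] (2.9)∕(2.12): `Q(∂μ) = ∂_cλ ∧ R∂*∂μ = 0`) is a fine scalar with PRESCRIBED CENTRE VALUES `λ` (up to
a constant) and `R(Δμ) = 0`.  dag-n07-w7 g0's `N07FlatHFeasibility.exists_admissible_grad_of_flatKernel` obtains it from two displayed hypotheses: `hker`
(= (P): centres constant ∧ `R(Δμ) = 0` ⇒ `∂μ = 0` — this lineage's `N07PointFeasibilityOneLevel.pointFeasibility_oneLevel`, p620292) and the dimension count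
`hdim`.  AT ONE LEVEL both halves are a single rank–nullity sentence, typed here on the b05 carrier directly (no abstract real carriers needed):
the square ℂ-linear map `T(μ, β) := (Δ²μ − Q′ᴴβ, (μ(ny + c₀))_y)` on `(T_η → ℂ) × (T₁ → ℂ)` is INJECTIVE by (P) (`eq_const_of_biharmonic_of_centres`) and
`Q′ᴴ` injective (`B5Substitution125.QsOp_adjoint_injective`), hence ONTO (`LinearMap.injective_iff_surjective`).

WHAT THIS FILE DOES (namespace `Summit.QuantumFields.YangMills.BalabanUVNodes.N07PointFeasibilityOneLevelExistence`; `n = 2c₀+1` odd, every `d`, every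
unit torus `M`; `Δ = LapS (fine n M) n`, `Q′ = QsOp n M`, `R = RT n M` of `B5Identities197Torus`).
* §1 ★ `RT_LapS_eq_zero_of_biharmonic` — the converse of g0′'s `exists_biharmonic_of_RT_LapS_eq_zero`: `Δ²μ = Q′ᴴβ ⇒ R(Δμ) = 0` (`Δμ = Δ⁻¹Q′ᴴβ` is FIXED by
  `P = Δ⁻¹Q′ᴴ(Q′Δ⁻²Q′ᴴ)⁻¹Q′Δ⁻¹`: `B5Value126.PcT_mulVec` + `B5Substitution125.Minv_Mop_of_orth`); `RT_LapS_eq_zero_iff_exists_biharmonic` (the two forms of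
  «`Δμ ∈ ΔN(Q′)^⊥`»); ★ `eq_zero_of_biharmonic_of_centres_eq_zero` (the HOMOGENEOUS problem: `Δ²μ = Q′ᴴβ`, `μ` zero on the centres ⇒ `μ = 0 ∧ β = 0`).
* §2 ★★ `exists_biharmonic_sub_eq_of_centres` — FULL SURJECTIVITY: for every fine `h` and every centre datum `λ` there are `μ, β` with `Δ²μ − Q′ᴴβ = h` and
  `μ(ny + c₀) = λ(y)`; ★★★ `existsUnique_biharmonic_of_centres` (`h = 0`: for every `λ` EXACTLY ONE `μ` with `Δ²μ ∈ range Q′ᴴ` and centre values `λ`);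
  ★★★ `existsUnique_RT_LapS_eq_zero_of_centres` — THE `R`-FORM: for every `λ` exactly one `μ` with `R(Δμ) = 0` and centre values `λ` (existence =
  feasibility of the admissible pure gauge `∂μ` at the datum `∂_cλ`; uniqueness = (P)); `exists_RT_LapS_eq_zero_of_centres` (existence alone).
* §3 (A6 ∕ sanity) `eq_const_of_RT_LapS_eq_zero_of_centres_eq_const` (at a CONSTANT datum the unique solution is the constant, g0′'s theorem read back) and
  `existsUnique_RT_LapS_eq_zero_of_centres_zero` (datum `0` ⇒ the solution is `0`).
* §4 `RT_LapS_eq_zero_of_centres_add` ∕ `_smul` ∕ `_add_const` (the solution operator `λ ↦ μ_λ` is ℂ-linear and shifts with constants) and ★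
  `GradOp_eq_of_RT_LapS_eq_zero_of_centres_sub_const` (two solutions whose data differ by a constant have the SAME pure gauge `∂μ`: the admissible pure gauge at
  `∂_cλ` is unique — [B6] (2.35)'s critical configuration, read on pure gauges at one level).

HONEST FRAMING (binding).  Count-neutral helper; finite-dimensional linear algebra (rank–nullity over ℂ) on ONE torus at ONE averaging level (block side `n` odd,
true centres `ny + c₀`) over this lineage's landed (P) (p619405 · p619980 · p620292) and b05's typed `R` ∕ `Q′` ∕ `Δ⁻¹` letters (`B5Identities197Torus`,
`B5Value126`, `B5Substitution125`, `B5LaplaceInverse`) BY NAME; nothing of [B11]∕[B6]∕[B5]∕[3]'s analysis is asserted.  The MULTI-LEVEL statement for a nested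
family `D` (the record's heart family `Node00.cubeDomains`: `(P)_D`, equivalently dag-n07-w7's `sym K ≻ 0`) is NOT proved here and remains OPEN (dag-n07-w7 g6's (L2) road);
under road (a) of the K0 lineage neither (P) nor this existence statement is consumed — located-research insurance for the R0′-native junction.  The instantiation
of `N07FlatHFeasibility`'s ABSTRACT real carriers is not attempted (this file is the same sentence on the concrete complex torus carrier; the V1 ∕ record readings go
through p622344's transports).  `hker` at the record ∕ stub 1 ∕ K0⁷ ∕ K1⁹ NOT closed; N07 NOT discharged; counts unmoved; no summit statement is proved by this seat —
R4 closes the conditional finite-𝕋⁴ rung `BalabanLadder.UV` only; nothing continuum ∕ ℝ⁴ ∕ OS ∕ mass gap ∕ Clay.  No `sorry`, no `def`, no `instance`, no `notation`.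
-/

noncomputable section

open scoped BigOperators Matrix ComplexConjugate

namespace Summit.QuantumFields.YangMills.BalabanUVNodes.N07PointFeasibilityOneLevelExistence

open Literature.MathematicalPhysics.QuantumFieldTheory.Balaban1983to89
open B5Prop11Plancherel (Tor fine)
open B5Block118 (bpt QsOp)
open B5Action121 (LapS)
open B5LaplaceInverse (LapSinv Pker LapSinv_LapS_of_orth Pker_orth)
open B5Substitution125 (Mop Minv Mop_mulVec Minv_Mop_of_orth QsOp_adjoint_injective sum_QsOp_adjoint)
open B5Value126 (PcT PcT_mulVec)
open B5Identities197Torus (RT)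
open N07PointFeasibilityOneLevel (eq_const_of_biharmonic_of_centres exists_biharmonic_of_RT_LapS_eq_zero
  eq_const_of_centres_of_RT_LapS_eq_zero)

variable {d : ℕ} (n : ℕ) [NeZero n] (M : Fin d → ℕ) [hM : ∀ μ, NeZero (M μ)]

/-! ## §1  `R(Δμ) = 0 ⇔ Δ²μ ∈ range Q′ᴴ`; the homogeneous problem -/

section Forms

/-- ★ **`Δ²μ = Q′ᴴβ ⇒ R(Δμ) = 0`** (converse of `N07PointFeasibilityOneLevel.exists_biharmonic_of_RT_LapS_eq_zero`).  With `w := Δμ ⊥ 1`: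
`Δw = Q′ᴴβ` forces `β ⊥ 1` and `w = Δ⁻¹Q′ᴴβ`, which the projection `P = Δ⁻¹Q′ᴴ(Q′Δ⁻²Q′ᴴ)⁻¹Q′Δ⁻¹` of (1.70) fixes
(`(Q′Δ⁻²Q′ᴴ)⁻¹(Q′Δ⁻²Q′ᴴ)β = β` on `β ⊥ 1`); so `Rw = w − Pw − P_const w = 0`.
[cite: Balaban1984PropagatorsI, p.22, p.25, (1.69)-(1.70) pp.29-30; Balaban1984PropagatorsII, (2.10)-(2.12) p.225] -/
theorem RT_LapS_eq_zero_of_biharmonic (μ : Tor (fine n M) → ℂ) (β : Tor M → ℂ)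
    (hbi : LapS (fine n M) (n : ℂ) *ᵥ (LapS (fine n M) (n : ℂ) *ᵥ μ) = (QsOp n M)ᴴ *ᵥ β) :
    RT n M *ᵥ (LapS (fine n M) (n : ℂ) *ᵥ μ) = 0 := by
  have hnc : (n : ℂ) ≠ 0 := by exact_mod_cast NeZero.ne n
  set w := LapS (fine n M) (n : ℂ) *ᵥ μ with hw
  have hw0 : ∑ x, w x = 0 := B5DivOrth.sum_LapS (fine n M) (n : ℂ) μ
  -- `β ⊥ 1`
  have hβ0 : ∑ y, β y = 0 := by
    have h1 : ∑ x, ((QsOp n M)ᴴ *ᵥ β) x = 0 := by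
      rw [← hbi]
      exact B5DivOrth.sum_LapS (fine n M) (n : ℂ) w
    rwa [sum_QsOp_adjoint] at h1
  -- `w = Δ⁻¹Q′ᴴβ`
  have hwinv : LapSinv (fine n M) (n : ℂ) *ᵥ ((QsOp n M)ᴴ *ᵥ β) = w := by
    rw [← hbi, LapSinv_LapS_of_orth (fine n M) hnc w hw0]
  -- `P w = w`
  have hP : PcT n M (n : ℂ) *ᵥ w = w := by
    conv_lhs => rw [← hwinv]
    rw [PcT_mulVec, ← Mop_mulVec, Minv_Mop_of_orth n M (n : ℂ) hnc β hβ0, hwinv]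
  rw [RT, Matrix.sub_mulVec, Matrix.sub_mulVec, Matrix.one_mulVec, hP, Pker_orth (fine n M) hnc w hw0,
    sub_self, sub_zero]

/-- `R(Δμ) = 0 ⇔ ∃ β, Δ²μ = Q′ᴴβ` («`Δμ` orthogonal to `ΔN(Q′)`», both readings). [cite: Balaban1984PropagatorsI, p.25; Balaban1984PropagatorsII, (2.10)-(2.12) p.225] -/
theorem RT_LapS_eq_zero_iff_exists_biharmonic (μ : Tor (fine n M) → ℂ) :
    RT n M *ᵥ (LapS (fine n M) (n : ℂ) *ᵥ μ) = 0 ↔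
      ∃ β : Tor M → ℂ, LapS (fine n M) (n : ℂ) *ᵥ (LapS (fine n M) (n : ℂ) *ᵥ μ) = (QsOp n M)ᴴ *ᵥ β :=
  ⟨exists_biharmonic_of_RT_LapS_eq_zero n M μ, fun ⟨β, h⟩ => RT_LapS_eq_zero_of_biharmonic n M μ β h⟩

/-- ★ **The homogeneous problem has only the zero solution**: `n = 2c₀+1` odd, `Δ²μ = Q′ᴴβ` and `μ` ZERO on every block centre `ny + c₀` ⇒
`μ = 0` and `β = 0` — (P) (`eq_const_of_biharmonic_of_centres`: `μ` is constant, and the constant is its centre value `0`) plus the injectivity of `Q′ᴴ`.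
[cite: Balaban1984PropagatorsII, (2.22) p.226, (2.35) p.228; Balaban1987RG1, (0.4) p.253] -/
theorem eq_zero_of_biharmonic_of_centres_eq_zero (c₀ : Fin d → Fin n) (hc₀ : ∀ ν, 2 * (c₀ ν : ℕ) + 1 = n)
    (μ : Tor (fine n M) → ℂ) (β : Tor M → ℂ)
    (hbi : LapS (fine n M) (n : ℂ) *ᵥ (LapS (fine n M) (n : ℂ) *ᵥ μ) = (QsOp n M)ᴴ *ᵥ β)
    (hctr : ∀ y, μ (bpt n M y c₀) = 0) : μ = 0 ∧ β = 0 := by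
  have hconst := eq_const_of_biharmonic_of_centres n M c₀ hc₀ μ β hbi (fun y => by rw [hctr, hctr])
  have hμ0 : μ 0 = 0 := (hconst (bpt n M 0 c₀)).symm.trans (hctr 0)
  have hμ : μ = 0 := funext fun x => by rw [Pi.zero_apply, hconst x, hμ0]
  refine ⟨hμ, QsOp_adjoint_injective n M β ?_⟩
  rw [← hbi, hμ, Matrix.mulVec_zero, Matrix.mulVec_zero]

end Forms

/-! ## §2  Existence by rank–nullity: the square map `(μ, β) ↦ (Δ²μ − Q′ᴴβ, μ ∘ centres)` is injective, hence onto -/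

section Existence

/-- ★★ **FULL SURJECTIVITY.**  `n = 2c₀+1` odd: for every fine `h : T_η → ℂ` and every centre datum `λ : T₁ → ℂ` there are `μ`, `β` with
`Δ²μ − Q′ᴴβ = h` and `μ(ny + c₀) = λ(y)` for all `y`.  Proof: the ℂ-linear map `T(μ,β) := (Δ²μ − Q′ᴴβ, (μ(ny+c₀))_y)` of
`(T_η → ℂ) × (T₁ → ℂ)` to itself is injective (`eq_zero_of_biharmonic_of_centres_eq_zero`), hence surjective (rank–nullity,
`LinearMap.injective_iff_surjective`). [cite: Balaban1984PropagatorsII, (2.9)-(2.12) p.225, (2.35) p.228; Balaban1987RG1, (0.4) p.253] -/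
theorem exists_biharmonic_sub_eq_of_centres (c₀ : Fin d → Fin n) (hc₀ : ∀ ν, 2 * (c₀ ν : ℕ) + 1 = n)
    (h : Tor (fine n M) → ℂ) (lam : Tor M → ℂ) :
    ∃ (μ : Tor (fine n M) → ℂ) (β : Tor M → ℂ),
      LapS (fine n M) (n : ℂ) *ᵥ (LapS (fine n M) (n : ℂ) *ᵥ μ) - (QsOp n M)ᴴ *ᵥ β = h ∧
        ∀ y, μ (bpt n M y c₀) = lam y := by
  -- the square linear map `T`
  let A : (Tor (fine n M) → ℂ) →ₗ[ℂ] (Tor (fine n M) → ℂ) :=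
    (Matrix.mulVecLin (LapS (fine n M) (n : ℂ))).comp (Matrix.mulVecLin (LapS (fine n M) (n : ℂ)))
  let B : (Tor M → ℂ) →ₗ[ℂ] (Tor (fine n M) → ℂ) := Matrix.mulVecLin ((QsOp n M)ᴴ)
  let S : (Tor (fine n M) → ℂ) →ₗ[ℂ] (Tor M → ℂ) := LinearMap.pi fun y : Tor M => LinearMap.proj (bpt n M y c₀)
  let T : ((Tor (fine n M) → ℂ) × (Tor M → ℂ)) →ₗ[ℂ] ((Tor (fine n M) → ℂ) × (Tor M → ℂ)) :=
    LinearMap.prod (A.comp (LinearMap.fst ℂ _ _) - B.comp (LinearMap.snd ℂ _ _)) (S.comp (LinearMap.fst ℂ _ _))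
  have hT : ∀ p : (Tor (fine n M) → ℂ) × (Tor M → ℂ),
      T p = (LapS (fine n M) (n : ℂ) *ᵥ (LapS (fine n M) (n : ℂ) *ᵥ p.1) - (QsOp n M)ᴴ *ᵥ p.2,
        fun y => p.1 (bpt n M y c₀)) := fun p => rfl
  -- injective by (P) and the injectivity of `Q′ᴴ`
  have hinj : Function.Injective T := by
    intro p q hpq
    have h0 : T (p - q) = 0 := by rw [map_sub, hpq, sub_self]
    rw [hT] at h0
    obtain ⟨h1, h2⟩ := Prod.ext_iff.mp h0
    simp only [Prod.fst_sub, Prod.snd_sub, Prod.fst_zero, Prod.snd_zero] at h1 h2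
    have hz := eq_zero_of_biharmonic_of_centres_eq_zero n M c₀ hc₀ (p.1 - q.1) (p.2 - q.2) (sub_eq_zero.mp h1)
      (fun y => congrFun h2 y)
    exact Prod.ext (sub_eq_zero.mp hz.1) (sub_eq_zero.mp hz.2)
  -- hence surjective
  have hsurj : Function.Surjective T := LinearMap.injective_iff_surjective.mp hinj
  obtain ⟨⟨μ, β⟩, hμβ⟩ := hsurj (h, lam)
  rw [hT] at hμβ
  obtain ⟨h1, h2⟩ := Prod.ext_iff.mp hμβ
  exact ⟨μ, β, h1, fun y => congrFun h2 y⟩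

/-- ★★★ **EXISTENCE AND UNIQUENESS, biharmonic form.**  `n = 2c₀+1` odd: for every centre datum `λ : T₁ → ℂ` there is EXACTLY ONE fine `μ` with
`Δ²μ ∈ range Q′ᴴ` («`Δ²μ` block-constant up to the normalisation of `Q′ᴴ`») and `μ(ny + c₀) = λ(y)` for all `y`.
[cite: Balaban1984PropagatorsII, (2.9)-(2.12) p.225, (2.22) p.226, (2.35) p.228; Balaban1987RG1, (0.4) p.253] -/
theorem existsUnique_biharmonic_of_centres (c₀ : Fin d → Fin n) (hc₀ : ∀ ν, 2 * (c₀ ν : ℕ) + 1 = n) (lam : Tor M → ℂ) :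
    ∃! μ : Tor (fine n M) → ℂ,
      (∃ β : Tor M → ℂ, LapS (fine n M) (n : ℂ) *ᵥ (LapS (fine n M) (n : ℂ) *ᵥ μ) = (QsOp n M)ᴴ *ᵥ β) ∧
        ∀ y, μ (bpt n M y c₀) = lam y := by
  obtain ⟨μ, β, hμβ, hctr⟩ := exists_biharmonic_sub_eq_of_centres n M c₀ hc₀ 0 lam
  refine ⟨μ, ⟨⟨β, sub_eq_zero.mp hμβ⟩, hctr⟩, ?_⟩
  rintro μ' ⟨⟨β', hbi'⟩, hctr'⟩
  have hbi : LapS (fine n M) (n : ℂ) *ᵥ (LapS (fine n M) (n : ℂ) *ᵥ (μ' - μ)) = (QsOp n M)ᴴ *ᵥ (β' - β) := by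
    rw [Matrix.mulVec_sub, Matrix.mulVec_sub, Matrix.mulVec_sub, hbi', sub_eq_zero.mp hμβ]
  have hz := eq_zero_of_biharmonic_of_centres_eq_zero n M c₀ hc₀ (μ' - μ) (β' - β) hbi
    (fun y => by rw [Pi.sub_apply, hctr', hctr, sub_self])
  exact sub_eq_zero.mp hz.1

/-- ★★★ **EXISTENCE AND UNIQUENESS, `R`-form — the one-level R0′-native junction, BOTH halves.**  `n = 2c₀+1` odd, every `d`, every unit torus `M`:
for every centre datum `λ : T₁ → ℂ` there is EXACTLY ONE fine scalar `μ` on `T_η` with `R(Δμ) = 0` (`R` = the orthogonal projection onto `ΔN(Q′)` of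
[B5] p. 25, `RT`) and `μ(ny + c₀) = λ(y)` for all `y`.  EXISTENCE = feasibility of the ADMISSIBLE PURE GAUGE `∂μ` at the coarse datum `∂_cλ` for the
(0.4) centre-averaging (`Q(∂μ) = ∂_c(μ∘centres) = ∂_cλ`, `R∂*∂μ = 0` — the conclusion of `N07FlatHFeasibility.exists_admissible_grad_of_flatKernel`, here with
`hker` AND `hdim` discharged at one level); UNIQUENESS = (P) (`pointFeasibility_oneLevel`).  The multi-level statement is OPEN.
[cite: Balaban1984PropagatorsI, p.25; Balaban1984PropagatorsII, (2.9)-(2.12) p.225, (2.22) p.226, (2.35) p.228; Balaban1985Averaging, (11) p.18; Balaban1987RG1, (0.4) p.253] -/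
theorem existsUnique_RT_LapS_eq_zero_of_centres (c₀ : Fin d → Fin n) (hc₀ : ∀ ν, 2 * (c₀ ν : ℕ) + 1 = n) (lam : Tor M → ℂ) :
    ∃! μ : Tor (fine n M) → ℂ,
      RT n M *ᵥ (LapS (fine n M) (n : ℂ) *ᵥ μ) = 0 ∧ ∀ y, μ (bpt n M y c₀) = lam y := by
  simpa only [RT_LapS_eq_zero_iff_exists_biharmonic] using existsUnique_biharmonic_of_centres n M c₀ hc₀ lam

/-- Existence alone, `R`-form: every centre datum is attained by some `μ` with `R(Δμ) = 0`.
[cite: Balaban1984PropagatorsII, (2.9)-(2.12) p.225, (2.35) p.228; Balaban1987RG1, (0.4) p.253] -/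
theorem exists_RT_LapS_eq_zero_of_centres (c₀ : Fin d → Fin n) (hc₀ : ∀ ν, 2 * (c₀ ν : ℕ) + 1 = n) (lam : Tor M → ℂ) :
    ∃ μ : Tor (fine n M) → ℂ, RT n M *ᵥ (LapS (fine n M) (n : ℂ) *ᵥ μ) = 0 ∧ ∀ y, μ (bpt n M y c₀) = lam y :=
  (existsUnique_RT_LapS_eq_zero_of_centres n M c₀ hc₀ lam).exists

/-- Uniqueness alone, `R`-form, as an equality of two solutions (the (P) half, read back from the `∃!`).
[cite: Balaban1984PropagatorsII, (2.22) p.226, (2.35) p.228; Balaban1987RG1, (0.4) p.253] -/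
theorem eq_of_RT_LapS_eq_zero_of_centres_eq (c₀ : Fin d → Fin n) (hc₀ : ∀ ν, 2 * (c₀ ν : ℕ) + 1 = n)
    (μ μ' : Tor (fine n M) → ℂ) (hR : RT n M *ᵥ (LapS (fine n M) (n : ℂ) *ᵥ μ) = 0)
    (hR' : RT n M *ᵥ (LapS (fine n M) (n : ℂ) *ᵥ μ') = 0) (hctr : ∀ y, μ (bpt n M y c₀) = μ' (bpt n M y c₀)) : μ = μ' :=
  (existsUnique_RT_LapS_eq_zero_of_centres n M c₀ hc₀ (fun y => μ' (bpt n M y c₀))).unique ⟨hR, hctr⟩ ⟨hR', fun _ => rfl⟩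

end Existence

/-! ## §3  Sanity (A6): constant data -/

section Sanity

/-- At a CONSTANT centre datum `a` the unique solution is the constant function `a` (g0′'s `eq_const_of_centres_of_RT_LapS_eq_zero` read back:
centres constant ∧ `R(Δμ) = 0` ⇒ `μ` constant, and the constant is the centre value). [cite: Balaban1984PropagatorsII, (2.22) p.226; Balaban1987RG1, (0.4) p.253] -/
theorem eq_const_of_RT_LapS_eq_zero_of_centres_eq_const (c₀ : Fin d → Fin n) (hc₀ : ∀ ν, 2 * (c₀ ν : ℕ) + 1 = n) (a : ℂ)
    (μ : Tor (fine n M) → ℂ) (hR : RT n M *ᵥ (LapS (fine n M) (n : ℂ) *ᵥ μ) = 0) (hctr : ∀ y, μ (bpt n M y c₀) = a) :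
    μ = fun _ => a := by
  have hconst := eq_const_of_centres_of_RT_LapS_eq_zero n M c₀ hc₀ μ (fun y => by rw [hctr, hctr]) hR
  have h0 : μ 0 = a := (hconst (bpt n M 0 c₀)).symm.trans (hctr 0)
  funext x
  rw [hconst x, h0]

/-- The datum `0` is attained exactly by `μ = 0`. [cite: Balaban1984PropagatorsII, (2.22) p.226; Balaban1987RG1, (0.4) p.253] -/
theorem existsUnique_RT_LapS_eq_zero_of_centres_zero (c₀ : Fin d → Fin n) (hc₀ : ∀ ν, 2 * (c₀ ν : ℕ) + 1 = n)
    (μ : Tor (fine n M) → ℂ) (hR : RT n M *ᵥ (LapS (fine n M) (n : ℂ) *ᵥ μ) = 0) (hctr : ∀ y, μ (bpt n M y c₀) = 0) :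
    μ = 0 :=
  eq_const_of_RT_LapS_eq_zero_of_centres_eq_const n M c₀ hc₀ 0 μ hR hctr

end Sanity

/-! ## §4  The solution is linear in the datum; its gradient sees the datum only modulo constants (the admissible pure gauge at `∂_cλ` is unique) -/

section Linearity

/-- Solutions add: if `μ₁` solves the `R`-problem at the datum `λ₁` and `μ₂` at `λ₂`, then `μ₁ + μ₂` solves it at `λ₁ + λ₂` (so, with uniqueness, the
solution operator `λ ↦ μ_λ` is additive). [folklore] -/
theorem RT_LapS_eq_zero_of_centres_add (c₀ : Fin d → Fin n) {μ₁ μ₂ : Tor (fine n M) → ℂ} {lam₁ lam₂ : Tor M → ℂ}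
    (h₁ : RT n M *ᵥ (LapS (fine n M) (n : ℂ) *ᵥ μ₁) = 0 ∧ ∀ y, μ₁ (bpt n M y c₀) = lam₁ y)
    (h₂ : RT n M *ᵥ (LapS (fine n M) (n : ℂ) *ᵥ μ₂) = 0 ∧ ∀ y, μ₂ (bpt n M y c₀) = lam₂ y) :
    RT n M *ᵥ (LapS (fine n M) (n : ℂ) *ᵥ (μ₁ + μ₂)) = 0 ∧ ∀ y, (μ₁ + μ₂) (bpt n M y c₀) = (lam₁ + lam₂) y := by
  refine ⟨?_, fun y => by rw [Pi.add_apply, Pi.add_apply, h₁.2, h₂.2]⟩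
  rw [Matrix.mulVec_add, Matrix.mulVec_add, h₁.1, h₂.1, add_zero]

/-- Solutions scale: `a • μ` solves the `R`-problem at `a • λ` (homogeneity of the solution operator). [folklore] -/
theorem RT_LapS_eq_zero_of_centres_smul (c₀ : Fin d → Fin n) (a : ℂ) {μ : Tor (fine n M) → ℂ} {lam : Tor M → ℂ}
    (h : RT n M *ᵥ (LapS (fine n M) (n : ℂ) *ᵥ μ) = 0 ∧ ∀ y, μ (bpt n M y c₀) = lam y) :
    RT n M *ᵥ (LapS (fine n M) (n : ℂ) *ᵥ (a • μ)) = 0 ∧ ∀ y, (a • μ) (bpt n M y c₀) = (a • lam) y := by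
  refine ⟨?_, fun y => by rw [Pi.smul_apply, Pi.smul_apply, h.2]⟩
  rw [Matrix.mulVec_smul, Matrix.mulVec_smul, h.1, smul_zero]

/-- Shifting the datum by a constant shifts the solution by the same constant (`Δ` kills constants). [folklore] -/
theorem RT_LapS_eq_zero_of_centres_add_const (c₀ : Fin d → Fin n) (a : ℂ) {μ : Tor (fine n M) → ℂ} {lam : Tor M → ℂ}
    (h : RT n M *ᵥ (LapS (fine n M) (n : ℂ) *ᵥ μ) = 0 ∧ ∀ y, μ (bpt n M y c₀) = lam y) :
    RT n M *ᵥ (LapS (fine n M) (n : ℂ) *ᵥ (μ + fun _ : Tor (fine n M) => a)) = 0 ∧ ∀ y, (μ + fun _ : Tor (fine n M) => a) (bpt n M y c₀) = lam y + a := by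
  refine ⟨?_, fun y => by rw [Pi.add_apply, h.2]⟩
  rw [Matrix.mulVec_add, B5LaplaceSpectral.LapS_const, add_zero, h.1]

/-- ★ **The admissible pure gauge at `∂_cλ` is unique**: two `R`-solutions whose centre data differ by a CONSTANT have the same gradient `∂μ` — the pure gauge
`∂μ_λ` depends on `λ` only through the coarse pure gauge `∂_cλ` ([B6] (2.35): THE critical configuration at the datum; `n = 2c₀+1` odd).
[cite: Balaban1984PropagatorsII, (2.9)-(2.12) p.225, (2.35) p.228; Balaban1987RG1, (0.4) p.253] -/
theorem GradOp_eq_of_RT_LapS_eq_zero_of_centres_sub_const (c₀ : Fin d → Fin n) (hc₀ : ∀ ν, 2 * (c₀ ν : ℕ) + 1 = n) (a : ℂ)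
    (μ μ' : Tor (fine n M) → ℂ) (hR : RT n M *ᵥ (LapS (fine n M) (n : ℂ) *ᵥ μ) = 0)
    (hR' : RT n M *ᵥ (LapS (fine n M) (n : ℂ) *ᵥ μ') = 0) (hctr : ∀ y, μ' (bpt n M y c₀) = μ (bpt n M y c₀) + a) :
    B5Action121.GradOp (fine n M) (n : ℂ) *ᵥ μ' = B5Action121.GradOp (fine n M) (n : ℂ) *ᵥ μ := by
  have hsol := RT_LapS_eq_zero_of_centres_add_const n M c₀ a (μ := μ) (lam := fun y => μ (bpt n M y c₀)) ⟨hR, fun _ => rfl⟩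
  have heq : μ' = μ + fun _ => a :=
    eq_of_RT_LapS_eq_zero_of_centres_eq n M c₀ hc₀ μ' (μ + fun _ : Tor (fine n M) => a) hR' hsol.1 (fun y => by rw [hctr, hsol.2])
  funext i
  obtain ⟨x, ν⟩ := i
  rw [heq, B5Action121.GradOp_mulVec, B5Action121.GradOp_mulVec, B5Action121.sdiff_mulVec, B5Action121.sdiff_mulVec]
  simp only [Pi.add_apply]
  ring

end Linearity

end Summit.QuantumFields.YangMills.BalabanUVNodes.N07PointFeasibilityOneLevelExistence

end
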